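import Literature.MathematicalPhysics.QuantumFieldTheory.Balaban1983to89.Beta.KKTFluctuationUnique

/-!
# `BalabanUV.Beta.D1BFx.BoundedSuperposition` — road «BF-x» for binder row D1, slot (K), dictionary brick **B6′ (H-SUPERPOS)**, part 1:
# THE TYPED MINIMISER COLUMNS SUPERPOSED AGAINST BOUNDED COARSE DATA solve the `U = 1` KKT system, are bounded, and are THE tempered
# solution with that data (uniqueness packaging)

HONEST FRAMING (cell contract, verbatim): «discharging `BetaPertH` makes Bałaban's UV stability UNCONDITIONAL — a real constructive-QFT
result; it is NOT the continuum limit and NOT the Clay problem.»  HONEST DEPENDENCY (verbatim): «continuum YM on T⁴ ⇐ BetaPertH ∧ nine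
spine estimates (0/9 proved); BetaPertH ⇐ (D1) ∧ (D4) ∧ CAP+tail; G-an2-4 gates asym, D1 and NE2/3/4.»  THIS MODULE DISCHARGES NOTHING of
D1 / BetaPertH.  It is [folklore] bookkeeping over an2's typed objects (`KernelSpecInstance.Hop/Φop/Mop`, `wH/wΦ/wM`, their column
identities `wH_EL/wH_G/wH_Q`, `KKTFluctuationUnique.wM_M`, their exponential decay `decay_wH/decay_wΦ/decay_wM`, and the uniqueness
theorem `KKTFluctuationUnique.unique_of_solvesKKT`), all USED BY NAME.  No `def`, no `Prop` is minted, nothing is cited, 0 sorry.  NOT summit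
progress; NOT BetaPertH, NOT continuum, NOT Clay.

ABSOLUTE RULE (cell, verbatim): «No internally-minted statement may enter as a cited fact. Every hypothesis is either kernel-proved in this
package or a verbatim quotation of a PUBLISHED theorem with page reference. The manuscript(s) under audit are NOT citable for their own
disputed steps — they are the thing under adjudication; programme-internal (2001/route/tribunal) claims are never citable.»

WHY (owner ruling ρ-g5-2, `HOME/b2b-balaban-beta-d1-p2/DICT-BRICKS.md` v1.2 brick B6′; K-R1-SPEC v2 §2 (D-H), §4 X₁).  The kernel dictionary
of slot (K) identifies the typed sharp resolvent (`KernelSpecInstance.wH/wΦ`, `KKTFluctuationKernel.Gam`) with columns built from the road's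
R-weighted legs via UNIQUENESS of tempered solutions.  `Beta/KernelSpecInstance` superposes the minimiser columns `wH(·; l, y)` against
AFFINE coarse data only (`hasSum_Hop`, `Q_Hop`, `EL_Hop`, `gauge_Hop` carry `IsAffine b`), because that is what affine reproduction needs.
The dictionary needs the same superposition against BOUNDED data `c` (the block averages `c := 𝒬(Ga𝒬ᵀω)` of a candidate column are bounded,
not affine): then `unique_of_solvesKKT` compares the candidate with `(Hop c, Φop c, Mop c)` DIRECTLY, and the coarse identity
`(wΦ + a′)·(𝒬Ga𝒬ᵀ) = c₀·1` (debt X₁b of K-R1-SPEC v2 §4) becomes a COROLLARY of X₁a instead of a second displayed hypothesis (part 2,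
`D1BFx/LandauResolventSuperposition`).  This file is the data-class extension; nothing in it mentions the road's legs.

CONTENT (all [folklore]; every `d`, block side `N ≥ 1`; "bounded data" = `∀ l y, |b l y| ≤ M`).
* §1 `summable_decimated_of_bdd`, `hasSum_kernelOpSum_of_bdd` — the decimated family `y ↦ w_{κl}(x − N•y)·b_l(y)` of an exponentially
  decaying kernel entry against bounded data is summable (injective sub-family of `Σ_z e^{−δ|z|₁}`), and `kernelOpSum` is its sum;
  `tsum_exp_decimated_le` (the sub-family sum is `≤ Σ_z e^{−δ|z|₁}`, uniformly in `x`), `abs_kernelOpSum_le_of_bdd` (uniform bound).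
* §2 `hasSum_Hop_bdd`, `hasSum_Φop_bdd`, `hasSum_Mop_bdd`; uniform bounds `exists_bdd_Hop`, `exists_bdd_Φop`, `exists_bdd_Mop` and
  temperedness `tempered_Hop_bdd`, `tempered_Φop_bdd`, `tempered_Mop_bdd`.
* §3 the four identities for bounded data: `Q_Hop_bdd` (`𝒬(H b) = b`), `EL_Hop_bdd` (`d*d(H b) = 𝒬ᵀ(Φ b) + dδd(M b)`), `gauge_Hop_bdd`
  (`δdδ(H b)` block-constant), `mean_Mop_bdd` (block sums of `M b` vanish) — the proofs of `KernelSpecInstance` verbatim with the §2 sums;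
  packaged as **`solvesKKT_Hop_bdd : SolvesKKT N 0 b (Hop b) (Φop b) (Mop b)`**.
* §4 **`eq_Hop_of_solvesKKT_bdd`** — THE TYPED SUPERPOSITION IS CANONICAL: a tempered triple solving the force-free system with bounded
  block averages `b` IS `(Hop b, Φop b, Mop b)`.
Unit `b2b-balaban-beta-d1-p2` (road owner, gen 5).
-/

noncomputable section

namespace Summit.QuantumFields.BalabanUV.Beta.D1BFx.BoundedSuperposition

open Finset
open scoped BigOperators
open Literature.MathematicalPhysics.QuantumFieldTheory.Balaban1983to89
open Literature.MathematicalPhysics.QuantumFieldTheory.Balaban1983to89.Beta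
open AffineAveraging (Form0 Form1 Form2 unitVec dz curv curvAdj codiff₁ box toSite blockSum contourSum)
open AffineReproduction (contourSumAdj IsBlockConst)
open B12Sec2to5 (l1 l1_nonneg Decay510 summable_exp_neg_l1)
open KernelRepresentationSummable (kernelOpSum kernelOpSum_apply_eq_decimated)
open KernelSpecInstance (wH wΦ wM wH_EL wH_G wH_Q decay_wH decay_wM decay_wΦ Hop Φop Mop
  hasSum_dz hasSum_curv hasSum_curvAdj hasSum_codiff₁ hasSum_contourSum hasSum_contourSumAdj
  op₁₁_superpos op₁₀_superpos op₀₁_superpos opEL opG opM opQ opΦ opEL_apply opG_apply opM_apply opQ_apply opΦ_apply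
  opEL_shift opG_shift opM_shift contourSum_shift contourSumAdj_shift)
open KKTFluctuationUnique (SolvesKKT Tempered0 Tempered1 unique_of_solvesKKT wM_M abs_le_of_decay510)
open KKTFluctuationKernel (blockSum_shift)

variable {d N : ℕ}

/-! ## §1 Decimated families of a decaying kernel entry against bounded data -/

section Decimated

variable {n : ℕ}

/-- [folklore] The decimation map `y ↦ x − M•y` is injective for `M ≠ 0`. -/
theorem decimate_injective {M : ℕ} (hM : M ≠ 0) (x : Fin n → ℤ) :
    Function.Injective (fun y : Fin n → ℤ => x - (M : ℤ) • y) := by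
  have hMz : (M : ℤ) ≠ 0 := by exact_mod_cast hM
  intro y y' h
  have h' : (M : ℤ) • y = (M : ℤ) • y' := sub_right_injective h
  funext i
  have hi := congr_fun h' i
  simp only [Pi.smul_apply, smul_eq_mul] at hi
  exact mul_left_cancel₀ hMz hi

/-- [folklore] The decimated exponential family `y ↦ e^{−δ|x − M•y|₁}` is summable (an injective sub-family of `Σ_z e^{−δ|z|₁}`). -/
theorem summable_exp_decimated {M : ℕ} (hM : M ≠ 0) {δ : ℝ} (hδ : 0 < δ) (x : Fin n → ℤ) :
    Summable (fun y : Fin n → ℤ => Real.exp (-δ * l1 (x - (M : ℤ) • y))) :=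
  (summable_exp_neg_l1 hδ n).comp_injective (decimate_injective hM x)

/-- [folklore] … and its sum is at most the full lattice sum `Σ_z e^{−δ|z|₁}`, UNIFORMLY in `x`. -/
theorem tsum_exp_decimated_le {M : ℕ} (hM : M ≠ 0) {δ : ℝ} (hδ : 0 < δ) (x : Fin n → ℤ) :
    ∑' y : Fin n → ℤ, Real.exp (-δ * l1 (x - (M : ℤ) • y)) ≤ ∑' z : Fin n → ℤ, Real.exp (-δ * l1 z) :=
  tsum_comp_le_tsum_of_inj (summable_exp_neg_l1 hδ n) (fun _ => (Real.exp_pos _).le) (decimate_injective hM x)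

/-- [folklore] The constant of an exponential-decay bound is nonnegative. -/
theorem nonneg_of_decay510 {f : (Fin n → ℤ) → ℝ} {C δ : ℝ} (hf : Decay510 f C δ) : 0 ≤ C := by
  have h := hf 0
  have h1 : Real.exp (-δ * l1 (0 : Fin n → ℤ)) = 1 := by simp [l1]
  rw [h1, mul_one] at h
  exact (abs_nonneg _).trans h

/-- [folklore] **The decimated family of a decaying kernel entry against BOUNDED data is summable**:
`y ↦ f(x − M•y)·b_l(y)` with `|f(z)| ≤ C e^{−δ|z|₁}`, `|b| ≤ B`. -/
theorem summable_decimated_of_bdd {M : ℕ} (hM : M ≠ 0) {f : (Fin n → ℤ) → ℝ} {C δ : ℝ} (hδ : 0 < δ)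
    (hf : Decay510 f C δ) {b : Form1 n ℝ} {B : ℝ} (hb : ∀ l y, |b l y| ≤ B) (l : Fin n) (x : Fin n → ℤ) :
    Summable (fun y : Fin n → ℤ => f (x - (M : ℤ) • y) * b l y) := by
  refine Summable.of_norm_bounded (((summable_exp_decimated hM hδ x).mul_left C).mul_right B) fun y => ?_
  rw [Real.norm_eq_abs, abs_mul]
  exact mul_le_mul (hf _) (hb l y) (abs_nonneg _) ((abs_nonneg _).trans (hf _))

/-- [folklore] The termwise majorant, summed: `|Σ'_y f(x − M•y)·b_l(y)| ≤ C·B·Σ_z e^{−δ|z|₁}`, uniformly in `x`. -/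
theorem abs_tsum_decimated_le {M : ℕ} (hM : M ≠ 0) {f : (Fin n → ℤ) → ℝ} {C δ : ℝ} (hδ : 0 < δ)
    (hf : Decay510 f C δ) {b : Form1 n ℝ} {B : ℝ} (hb : ∀ l y, |b l y| ≤ B) (l : Fin n) (x : Fin n → ℤ) :
    |∑' y : Fin n → ℤ, f (x - (M : ℤ) • y) * b l y| ≤ C * B * ∑' z : Fin n → ℤ, Real.exp (-δ * l1 z) := by
  have hC : 0 ≤ C := nonneg_of_decay510 hf
  have hB : 0 ≤ B := (abs_nonneg _).trans (hb l x)
  have hmaj : HasSum (fun y : Fin n → ℤ => C * Real.exp (-δ * l1 (x - (M : ℤ) • y)) * B)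
      (C * (∑' y : Fin n → ℤ, Real.exp (-δ * l1 (x - (M : ℤ) • y))) * B) :=
    (((summable_exp_decimated hM hδ x).hasSum).mul_left C).mul_right B
  have h1 : ‖∑' y : Fin n → ℤ, f (x - (M : ℤ) • y) * b l y‖
      ≤ C * (∑' y : Fin n → ℤ, Real.exp (-δ * l1 (x - (M : ℤ) • y))) * B :=
    HasSum.norm_le_of_bounded (summable_decimated_of_bdd hM hδ hf hb l x).hasSum hmaj fun y => by
      rw [Real.norm_eq_abs, abs_mul]
      exact mul_le_mul (hf _) (hb l y) (abs_nonneg _) ((abs_nonneg _).trans (hf _))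
  rw [Real.norm_eq_abs] at h1
  refine h1.trans ?_
  have h2 := tsum_exp_decimated_le hM hδ x (n := n)
  calc C * (∑' y : Fin n → ℤ, Real.exp (-δ * l1 (x - (M : ℤ) • y))) * B
      = C * B * (∑' y : Fin n → ℤ, Real.exp (-δ * l1 (x - (M : ℤ) • y))) := by ring
    _ ≤ C * B * ∑' z : Fin n → ℤ, Real.exp (-δ * l1 z) := mul_le_mul_of_nonneg_left h2 (mul_nonneg hC hB)

/-- [folklore] **`kernelOpSum` ON BOUNDED DATA IS THE SUM OVER THE SOURCES** `(l, y)` of `w_{κl}(x − M•y)·b_l(y)` (inner sum over `l`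
finite, outer sum over `y` unconditional), for kernel entries with a common exponential decay. -/
theorem hasSum_kernelOpSum_of_bdd {M : ℕ} (hM : M ≠ 0) (w : Fin n → Fin n → (Fin n → ℤ) → ℝ) {C δ : ℝ} (hδ : 0 < δ)
    (hw : ∀ κ l, Decay510 (w κ l) C δ) {b : Form1 n ℝ} {B : ℝ} (hb : ∀ l y, |b l y| ≤ B) (κ : Fin n) (x : Fin n → ℤ) :
    HasSum (fun y : Fin n → ℤ => ∑ l, w κ l (x - (M : ℤ) • y) * b l y) (kernelOpSum M w b κ x) := by
  rw [kernelOpSum_apply_eq_decimated hM]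
  exact hasSum_sum fun l _ => (summable_decimated_of_bdd hM hδ (hw κ l) hb l x).hasSum

/-- [folklore] **UNIFORM BOUND**: `|kernelOpSum M w b κ x| ≤ n·C·B·Σ_z e^{−δ|z|₁}` for bounded data. -/
theorem abs_kernelOpSum_le_of_bdd {M : ℕ} (hM : M ≠ 0) (w : Fin n → Fin n → (Fin n → ℤ) → ℝ) {C δ : ℝ} (hδ : 0 < δ)
    (hw : ∀ κ l, Decay510 (w κ l) C δ) {b : Form1 n ℝ} {B : ℝ} (hb : ∀ l y, |b l y| ≤ B) (κ : Fin n) (x : Fin n → ℤ) :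
    |kernelOpSum M w b κ x| ≤ n * (C * B * ∑' z : Fin n → ℤ, Real.exp (-δ * l1 z)) := by
  rw [kernelOpSum_apply_eq_decimated hM]
  refine (Finset.abs_sum_le_sum_abs _ _).trans ?_
  have h : ∀ l ∈ (Finset.univ : Finset (Fin n)),
      |∑' y : Fin n → ℤ, w κ l (x - (M : ℤ) • y) * b l y| ≤ C * B * ∑' z : Fin n → ℤ, Real.exp (-δ * l1 z) :=
    fun l _ => abs_tsum_decimated_le hM hδ (hw κ l) hb l x
  refine (Finset.sum_le_sum h).trans ?_
  rw [Finset.sum_const, Finset.card_univ, Fintype.card_fin, nsmul_eq_mul]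

end Decimated

/-! ## §2 The three superposed typed columns on bounded data: sums, bounds, temperedness -/

section Sums

variable [NeZero N]

/-- [folklore] `H b` as the sum over the sources, for BOUNDED coarse data `b`. -/
theorem hasSum_Hop_bdd {b : Form1 (d + 1) ℝ} {B : ℝ} (hb : ∀ l y, |b l y| ≤ B) (κ : Fin (d + 1)) (x : AffineAveraging.Site (d + 1)) :
    HasSum (fun y : AffineAveraging.Site (d + 1) => ∑ l, wH (N := N) κ l (x - (N : ℤ) • y) * b l y) (Hop (N := N) b κ x) := by
  obtain ⟨δ, C, hδ, hw⟩ := decay_wH (N := N) (d := d)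
  exact hasSum_kernelOpSum_of_bdd (NeZero.ne N) _ hδ hw hb κ x

/-- [folklore] `Φ b` as the sum over the sources, for BOUNDED coarse data `b`. -/
theorem hasSum_Φop_bdd {b : Form1 (d + 1) ℝ} {B : ℝ} (hb : ∀ l y, |b l y| ≤ B) (κ : Fin (d + 1)) (q : AffineAveraging.Site (d + 1)) :
    HasSum (fun y : AffineAveraging.Site (d + 1) => ∑ l, wΦ (N := N) κ l (q - y) * b l y) (Φop (N := N) b κ q) := by
  obtain ⟨δ, C, hδ, hw⟩ := decay_wΦ (N := N) (d := d)
  have h := hasSum_kernelOpSum_of_bdd one_ne_zero _ hδ hw hb κ q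
  simp only [Nat.cast_one, one_smul] at h
  exact h

/-- [folklore] `M b` as the sum over the sources, for BOUNDED coarse data `b`. -/
theorem hasSum_Mop_bdd {b : Form1 (d + 1) ℝ} {B : ℝ} (hb : ∀ l y, |b l y| ≤ B) (x : AffineAveraging.Site (d + 1)) :
    HasSum (fun y : AffineAveraging.Site (d + 1) => ∑ l, wM (N := N) l (x - (N : ℤ) • y) * b l y) (Mop (N := N) b x) := by
  obtain ⟨δ, C, hδ, hw⟩ := decay_wM (N := N) (d := d)
  exact hasSum_kernelOpSum_of_bdd (NeZero.ne N) (fun _ l => wM (N := N) l) hδ (fun _ l => hw l) hb 0 x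

/-- [folklore] `H b` is uniformly bounded for bounded data. -/
theorem exists_bdd_Hop {b : Form1 (d + 1) ℝ} {B : ℝ} (hb : ∀ l y, |b l y| ≤ B) :
    ∃ B' : ℝ, ∀ κ x, |Hop (N := N) b κ x| ≤ B' := by
  obtain ⟨δ, C, hδ, hw⟩ := decay_wH (N := N) (d := d)
  exact ⟨_, fun κ x => abs_kernelOpSum_le_of_bdd (NeZero.ne N) _ hδ hw hb κ x⟩

/-- [folklore] `Φ b` is uniformly bounded for bounded data. -/
theorem exists_bdd_Φop {b : Form1 (d + 1) ℝ} {B : ℝ} (hb : ∀ l y, |b l y| ≤ B) :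
    ∃ B' : ℝ, ∀ κ q, |Φop (N := N) b κ q| ≤ B' := by
  obtain ⟨δ, C, hδ, hw⟩ := decay_wΦ (N := N) (d := d)
  exact ⟨_, fun κ q => abs_kernelOpSum_le_of_bdd one_ne_zero _ hδ hw hb κ q⟩

/-- [folklore] `M b` is uniformly bounded for bounded data. -/
theorem exists_bdd_Mop {b : Form1 (d + 1) ℝ} {B : ℝ} (hb : ∀ l y, |b l y| ≤ B) :
    ∃ B' : ℝ, ∀ x, |Mop (N := N) b x| ≤ B' := by
  obtain ⟨δ, C, hδ, hw⟩ := decay_wM (N := N) (d := d)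
  exact ⟨_, fun x => abs_kernelOpSum_le_of_bdd (NeZero.ne N) (fun _ l => wM (N := N) l) hδ (fun _ l => hw l) hb 0 x⟩

/-- [folklore] `H b` is tempered for bounded data. -/
theorem tempered_Hop_bdd {b : Form1 (d + 1) ℝ} {B : ℝ} (hb : ∀ l y, |b l y| ≤ B) : Tempered1 (Hop (N := N) b) := by
  obtain ⟨B', h⟩ := exists_bdd_Hop (N := N) hb
  exact Tempered1.of_bounded h

/-- [folklore] `Φ b` is tempered for bounded data. -/
theorem tempered_Φop_bdd {b : Form1 (d + 1) ℝ} {B : ℝ} (hb : ∀ l y, |b l y| ≤ B) : Tempered1 (Φop (N := N) b) := by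
  obtain ⟨B', h⟩ := exists_bdd_Φop (N := N) hb
  exact Tempered1.of_bounded h

/-- [folklore] `M b` is tempered for bounded data. -/
theorem tempered_Mop_bdd {b : Form1 (d + 1) ℝ} {B : ℝ} (hb : ∀ l y, |b l y| ≤ B) : Tempered0 (Mop (N := N) b) := by
  obtain ⟨B', h⟩ := exists_bdd_Mop (N := N) hb
  exact Tempered0.of_bounded h

end Sums

/-! ## §3 The four identities of the KKT system for bounded data -/

section Equations

variable [NeZero N]

/-- [folklore] **(Q) REPRODUCTION OF BOUNDED BLOCK AVERAGES**: `𝒬 (H b) = b`. -/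
theorem Q_Hop_bdd {b : Form1 (d + 1) ℝ} {B : ℝ} (hb : ∀ l y, |b l y| ≤ B) : contourSum N (Hop (N := N) b) = b := by
  funext κ y'
  have h1 : HasSum (fun y : AffineAveraging.Site (d + 1) =>
      contourSum N (fun κ' z => ∑ l, wH (N := N) κ' l (z - (N : ℤ) • y) * b l y) κ y') (contourSum N (Hop (N := N) b) κ y') :=
    hasSum_contourSum (fun κ' z => hasSum_Hop_bdd hb κ' z) κ y'
  have h2 : ∀ y : AffineAveraging.Site (d + 1),
      contourSum N (fun κ' z => ∑ l, wH (N := N) κ' l (z - (N : ℤ) • y) * b l y) κ y' = if y = y' then b κ y' else 0 := by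
    intro y
    have hs := op₁₁_superpos (opQ N) (fun l κ' z => wH (N := N) κ' l (z - (N : ℤ) • y)) (fun l => b l y) κ y'
    simp only [opQ_apply] at hs
    rw [hs]
    have ht : ∀ l, contourSum N (fun κ' z => wH (N := N) κ' l (z - (N : ℤ) • y)) κ y'
        = if y' - y = 0 ∧ κ = l then 1 else 0 := fun l => by
      rw [contourSum_shift (fun κ' z => wH (N := N) κ' l z) y κ y', wH_Q]
    simp only [ht, mul_ite, mul_one, mul_zero]
    by_cases hy : y = y'
    · subst hy
      simp
    · have : ¬ (y' - y = 0) := fun h => hy (sub_eq_zero.1 h).symm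
      simp [this, hy]
  simp only [h2] at h1
  exact h1.unique (hasSum_ite_eq y' (b κ y'))

/-- [folklore] **(EL) THE EULER–LAGRANGE EQUATION** for bounded data: `d*d (H b) = 𝒬ᵀ (Φ b) + d δ d (M b)`, pointwise. -/
theorem EL_Hop_bdd {b : Form1 (d + 1) ℝ} {B : ℝ} (hb : ∀ l y, |b l y| ≤ B) (μ : Fin (d + 1)) (x : AffineAveraging.Site (d + 1)) :
    curvAdj (curv (Hop (N := N) b)) μ x
      = contourSumAdj N (Φop (N := N) b) μ x + dz (codiff₁ (dz (Mop (N := N) b))) μ x := by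
  have hL : HasSum (fun y : AffineAveraging.Site (d + 1) =>
      curvAdj (curv (fun κ z => ∑ l, wH (N := N) κ l (z - (N : ℤ) • y) * b l y)) μ x)
      (curvAdj (curv (Hop (N := N) b)) μ x) :=
    hasSum_curvAdj (fun κ l z => hasSum_curv (fun κ z => hasSum_Hop_bdd hb κ z) κ l z) μ x
  have hΦ : HasSum (fun y : AffineAveraging.Site (d + 1) =>
      contourSumAdj N (fun κ q => ∑ l, wΦ (N := N) κ l (q - y) * b l y) μ x) (contourSumAdj N (Φop (N := N) b) μ x) :=
    hasSum_contourSumAdj (fun κ q => hasSum_Φop_bdd hb κ q) μ x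
  have hΨ : HasSum (fun y : AffineAveraging.Site (d + 1) =>
      dz (codiff₁ (dz (fun z => ∑ l, wM (N := N) l (z - (N : ℤ) • y) * b l y))) μ x)
      (dz (codiff₁ (dz (Mop (N := N) b))) μ x) :=
    hasSum_dz (fun z => hasSum_codiff₁ (fun κ z => hasSum_dz (fun z => hasSum_Mop_bdd hb z) κ z) z) μ x
  have hterm : ∀ y : AffineAveraging.Site (d + 1),
      curvAdj (curv (fun κ z => ∑ l, wH (N := N) κ l (z - (N : ℤ) • y) * b l y)) μ x
        = contourSumAdj N (fun κ q => ∑ l, wΦ (N := N) κ l (q - y) * b l y) μ x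
          + dz (codiff₁ (dz (fun z => ∑ l, wM (N := N) l (z - (N : ℤ) • y) * b l y))) μ x := by
    intro y
    have s1 := op₁₁_superpos opEL (fun l κ z => wH (N := N) κ l (z - (N : ℤ) • y)) (fun l => b l y) μ x
    have s2 := op₁₁_superpos (opΦ N) (fun l κ q => wΦ (N := N) κ l (q - y)) (fun l => b l y) μ x
    have s3 := op₀₁_superpos opM (fun l z => wM (N := N) l (z - (N : ℤ) • y)) (fun l => b l y) μ x
    simp only [opEL_apply, opΦ_apply, opM_apply] at s1 s2 s3
    rw [s1, s2, s3, ← Finset.sum_add_distrib]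
    refine Finset.sum_congr rfl fun l _ => ?_
    rw [← mul_add, opEL_shift (fun κ z => wH (N := N) κ l z) ((N : ℤ) • y) μ x, wH_EL,
      contourSumAdj_shift (fun κ q => wΦ (N := N) κ l q) y μ x, opM_shift (wM (N := N) l) ((N : ℤ) • y) μ x]
  simp only [hterm] at hL
  exact hL.unique (hΦ.add hΨ)

/-- [folklore] **(G) THE GAUGE QUANTITY `δdδ (H b)` IS BLOCK-CONSTANT** for bounded data. -/
theorem gauge_Hop_bdd {b : Form1 (d + 1) ℝ} {B : ℝ} (hb : ∀ l y, |b l y| ≤ B) :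
    IsBlockConst N (codiff₁ (dz (codiff₁ (Hop (N := N) b)))) := by
  intro y bb hbb
  have hG : ∀ x : AffineAveraging.Site (d + 1), HasSum (fun y'' : AffineAveraging.Site (d + 1) =>
      codiff₁ (dz (codiff₁ (fun κ z => ∑ l, wH (N := N) κ l (z - (N : ℤ) • y'') * b l y''))) x)
      (codiff₁ (dz (codiff₁ (Hop (N := N) b))) x) := fun x =>
    hasSum_codiff₁ (fun κ z => hasSum_dz (fun z => hasSum_codiff₁ (fun κ z => hasSum_Hop_bdd hb κ z) z) κ z) x
  have hterm : ∀ y'' : AffineAveraging.Site (d + 1),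
      codiff₁ (dz (codiff₁ (fun κ z => ∑ l, wH (N := N) κ l (z - (N : ℤ) • y'') * b l y''))) ((N : ℤ) • y + toSite bb)
        = codiff₁ (dz (codiff₁ (fun κ z => ∑ l, wH (N := N) κ l (z - (N : ℤ) • y'') * b l y''))) ((N : ℤ) • y) := by
    intro y''
    have s1 := op₁₀_superpos opG (fun l κ z => wH (N := N) κ l (z - (N : ℤ) • y'')) (fun l => b l y'')
      ((N : ℤ) • y + toSite bb)
    have s2 := op₁₀_superpos opG (fun l κ z => wH (N := N) κ l (z - (N : ℤ) • y'')) (fun l => b l y'')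
      ((N : ℤ) • y)
    simp only [opG_apply] at s1 s2
    rw [s1, s2]
    refine Finset.sum_congr rfl fun l _ => ?_
    rw [opG_shift (fun κ z => wH (N := N) κ l z) ((N : ℤ) • y'') ((N : ℤ) • y + toSite bb),
      opG_shift (fun κ z => wH (N := N) κ l z) ((N : ℤ) • y'') ((N : ℤ) • y),
      show (N : ℤ) • y + toSite bb - (N : ℤ) • y'' = (N : ℤ) • (y - y'') + toSite bb by rw [smul_sub]; abel,
      show (N : ℤ) • y - (N : ℤ) • y'' = (N : ℤ) • (y - y'') by rw [smul_sub], wH_G (N := N) l (y - y'') hbb]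
  have h1 := hG ((N : ℤ) • y + toSite bb)
  simp only [hterm] at h1
  exact h1.unique (hG ((N : ℤ) • y))

omit [NeZero N] in
/-- [folklore] Block sums of a 0-form pass through a pointwise `HasSum` family (finite sum over the block). -/
theorem hasSum_blockSum {ι : Type*} {F : ι → Form0 (d + 1) ℝ} {f : Form0 (d + 1) ℝ} (h : ∀ x, HasSum (fun i => F i x) (f x))
    (y : AffineAveraging.Site (d + 1)) : HasSum (fun i => blockSum N (F i) y) (blockSum N f y) := by
  simp only [blockSum]; exact hasSum_sum fun bb _ => h _

omit [NeZero N] in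
/-- [folklore] Block sums pass through a finite superposition of 0-forms. -/
theorem blockSum_superpos {n : ℕ} (W : Fin n → Form0 (d + 1) ℝ) (c : Fin n → ℝ) (y : AffineAveraging.Site (d + 1)) :
    blockSum N (fun z => ∑ l, W l z * c l) y = ∑ l, c l * blockSum N (W l) y := by
  simp only [blockSum, Finset.mul_sum]
  rw [Finset.sum_comm]
  exact Finset.sum_congr rfl fun l _ => Finset.sum_congr rfl fun bb _ => mul_comm _ _

/-- [folklore] **(M) THE GAUGE MULTIPLIER POTENTIAL HAS ZERO BLOCK SUMS** for bounded data: `blockSum N (M b) y = 0`. -/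
theorem mean_Mop_bdd {b : Form1 (d + 1) ℝ} {B : ℝ} (hb : ∀ l y, |b l y| ≤ B) (y : AffineAveraging.Site (d + 1)) :
    blockSum N (Mop (N := N) b) y = 0 := by
  have h1 : HasSum (fun y'' : AffineAveraging.Site (d + 1) =>
      blockSum N (fun z => ∑ l, wM (N := N) l (z - (N : ℤ) • y'') * b l y'') y) (blockSum N (Mop (N := N) b) y) :=
    hasSum_blockSum (fun z => hasSum_Mop_bdd hb z) y
  have h2 : ∀ y'' : AffineAveraging.Site (d + 1),
      blockSum N (fun z => ∑ l, wM (N := N) l (z - (N : ℤ) • y'') * b l y'') y = 0 := by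
    intro y''
    rw [blockSum_superpos]
    refine Finset.sum_eq_zero fun l _ => ?_
    rw [blockSum_shift (wM (N := N) l) y'' y, wM_M, mul_zero]
  simp only [h2] at h1
  exact h1.unique hasSum_zero

/-- [folklore] **THE TYPED SUPERPOSITION SOLVES THE FORCE-FREE `U = 1` KKT SYSTEM WITH BOUNDED BLOCK AVERAGES `b`.** -/
theorem solvesKKT_Hop_bdd {b : Form1 (d + 1) ℝ} {B : ℝ} (hb : ∀ l y, |b l y| ≤ B) :
    SolvesKKT N 0 b (Hop (N := N) b) (Φop (N := N) b) (Mop (N := N) b) where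
  el μ x := by rw [EL_Hop_bdd hb]; simp
  gauge := gauge_Hop_bdd hb
  mean := mean_Mop_bdd hb
  avg κ y := by rw [Q_Hop_bdd hb]

end Equations

/-! ## §4 Uniqueness packaging: the typed superposition is THE tempered solution with bounded data -/

section Unique

variable [NeZero N]

/-- [folklore] **THE TYPED SUPERPOSITION IS CANONICAL**: every TEMPERED triple solving the force-free `U = 1` KKT system with
BOUNDED block averages `b` is `(H b, Φ b, M b)` of `Beta/KernelSpecInstance` (by `KKTFluctuationUnique.unique_of_solvesKKT`). -/
theorem eq_Hop_of_solvesKKT_bdd {b A φ : Form1 (d + 1) ℝ} {μ : Form0 (d + 1) ℝ} {B : ℝ} (hb : ∀ l y, |b l y| ≤ B)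
    (h : SolvesKKT N 0 b A φ μ) (hA : Tempered1 A) (hφ : Tempered1 φ) (hμ : Tempered0 μ) :
    A = Hop (N := N) b ∧ φ = Φop (N := N) b ∧ μ = Mop (N := N) b :=
  unique_of_solvesKKT h (solvesKKT_Hop_bdd hb) hA hφ hμ (tempered_Hop_bdd hb) (tempered_Φop_bdd hb) (tempered_Mop_bdd hb)

/-- [folklore] The same, read entrywise through the source sums: the fine field of such a triple is
`A κ x = Σ'_y Σ_l wH κ l (x − N•y)·b l y`, its constraint multiplier `φ κ q = Σ'_y Σ_l wΦ κ l (q − y)·b l y`. -/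
theorem eq_tsum_of_solvesKKT_bdd {b A φ : Form1 (d + 1) ℝ} {μ : Form0 (d + 1) ℝ} {B : ℝ} (hb : ∀ l y, |b l y| ≤ B)
    (h : SolvesKKT N 0 b A φ μ) (hA : Tempered1 A) (hφ : Tempered1 φ) (hμ : Tempered0 μ)
    (κ : Fin (d + 1)) (x : AffineAveraging.Site (d + 1)) :
    A κ x = ∑' y : AffineAveraging.Site (d + 1), ∑ l, wH (N := N) κ l (x - (N : ℤ) • y) * b l y
      ∧ φ κ x = ∑' y : AffineAveraging.Site (d + 1), ∑ l, wΦ (N := N) κ l (x - y) * b l y := by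
  obtain ⟨h1, h2, -⟩ := eq_Hop_of_solvesKKT_bdd hb h hA hφ hμ
  exact ⟨by rw [h1, (hasSum_Hop_bdd hb κ x).tsum_eq], by rw [h2, (hasSum_Φop_bdd hb κ x).tsum_eq]⟩

end Unique

end Summit.QuantumFields.BalabanUV.Beta.D1BFx.BoundedSuperposition

end
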